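import Mathlib

/-!
# Termination of GRK chains (the combinatorial skeleton of THEOREM H of card `decorated-colength-law`)

(crux stmt-ResolutionOfSingularities-15640 `WildQuotients.WildQuotientResolution`, R-lane of
`L/w45c/CHAIN.md` v7.9: ideator res-L1-w45c-idea-1, card H `decorated-colength-law`, steps H3
`stub_grkChain_finite` and H3′ `stub_grkChain_length_le` of `L/res-L1-w45c-idea-1/Sketch-L1-idea-1.lean`
v6 §H; R-lane work named to this seat by res-L1-w45c-plan-1 2026-08-27T09:38:47Z.
[OURS · L1 W4.5c] — NOT a statement of any manuscript; replaces the role of no printed item.)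

Pure combinatorics, DEF-FREE (the idea card's `DNode`/`GRK`/`GRKLaw` are research vocabulary of a crux
workfile and are not landed here): a "chain" is given by its coordinate sequences — a type sequence
`typ : ℕ → α` in an arbitrary type `α` with three pairwise distinct letters `G R K`, the
passenger–boundary contact `ip : ℕ → ℕ`, the residual boundary multiplicity `mbar`, the residual
passenger order `bbar` and the case flag `caseI` — and the **GRK chain law** at step `n` is the
proposition (verbatim the body of idea-1's `GRKLaw (c n) (c (n+1))` with `StationaryConfig` unfolded)
* `ip (n+1) ≤ ip n`;
* if `ip (n+1) = ip n > 0` then the step is one of the two STATIONARY CONFIGURATIONS: a case-II `G`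
  point with `mbar = 1` followed by an `R` point, or a case-I `K` point with `bbar = 1` followed by a
  `G` point with `mbar ≥ 2`;
* if `ip n = 0` then the step is `R → K` and `ip (n+1) = 0`.
Results: `GRKChain.length_le` — a chain obeying the law for `n < L` has `L ≤ 2·ip 0 + 1` (H3′: after
a stationary step the next step drops `ip`, because an `R` point and a `G` point with `mbar ≥ 2`
admit no stationary configuration; at `ip = 0` only one step `R → K` is possible); hence
`GRKChain.not_infinite` — no infinite chain obeys the law (H3). Idea-1's stubs are the instances
`typ := fun n => (c n).typ`, …, with `G R K := GRK.G GRK.R GRK.K` (distinct by `decide`).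
-/

-- single-problem summit: the doubled namespace component `ResolutionOfSingularities` is forced
set_option linter.dupNamespace false

namespace Summit.ResolutionOfSingularities.ResolutionOfSingularities.Theorems.WildQuotientResolution.GRKChain

variable {α : Type*}

/-- **H3′ · explicit depth bound for GRK chains**: if the GRK chain law holds at every step `n < L`,
then `L ≤ 2 · ip 0 + 1`. [OURS · L1 W4.5c] -/
theorem length_le {G R K : α} (hGR : G ≠ R) (hGK : G ≠ K) (hRK : R ≠ K) :
    ∀ (i : ℕ) (typ : ℕ → α) (ip mbar bbar : ℕ → ℕ) (caseI : ℕ → Bool) (L : ℕ),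
      ip 0 = i →
      (∀ n < L, ip (n + 1) ≤ ip n ∧
        (ip (n + 1) = ip n → 0 < ip n →
          (typ n = G ∧ caseI n = false ∧ mbar n = 1 ∧ typ (n + 1) = R) ∨
          (typ n = K ∧ caseI n = true ∧ bbar n = 1 ∧ typ (n + 1) = G ∧ 2 ≤ mbar (n + 1))) ∧
        (ip n = 0 → typ n = R ∧ typ (n + 1) = K ∧ ip (n + 1) = 0)) →
      L ≤ 2 * i + 1 := by
  intro i
  induction i using Nat.strong_induction_on with
  | _ i IH =>
    intro typ ip mbar bbar caseI L h0 hlaw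
    by_cases hL : L ≤ 1
    · omega
    have h0law := hlaw 0 (by omega)
    have h1law := hlaw 1 (by omega)
    simp only [zero_add, Nat.reduceAdd] at h0law h1law
    rcases Nat.eq_zero_or_pos i with hi | hi
    · -- `ip 0 = 0`: the step `0 → 1` is `R → K` with `ip 1 = 0`, and then step `1 → 2` is impossible
      subst hi
      obtain ⟨-, hK1, hip1⟩ := h0law.2.2 h0
      obtain ⟨hR1, -, -⟩ := h1law.2.2 hip1
      exact absurd (hR1.symm.trans hK1) hRK
    · rcases h0law.1.lt_or_eq with hlt | heq
      · -- strict drop at step `0`: induction on the shifted chain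
        have h := IH (ip 1) (by omega) (fun n => typ (n + 1)) (fun n => ip (n + 1))
          (fun n => mbar (n + 1)) (fun n => bbar (n + 1)) (fun n => caseI (n + 1)) (L - 1) rfl
          (fun n hn => hlaw (n + 1) (by omega))
        omega
      · -- stationary at step `0`; then step `1` must drop `ip`
        have hst := h0law.2.1 heq (by omega)
        have hlt2 : ip 2 < ip 1 := by
          rcases h1law.1.lt_or_eq with h | h
          · exact h
          · exfalso
            have hst1 := h1law.2.1 h (by omega)
            rcases hst with ⟨-, -, -, hR1⟩ | ⟨-, -, -, hG1, hm1⟩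
            · rcases hst1 with ⟨hG, -⟩ | ⟨hK, -⟩
              · exact hGR (hG.symm.trans hR1)
              · exact hRK (hR1.symm.trans hK)
            · rcases hst1 with ⟨-, -, hm, -⟩ | ⟨hK, -⟩
              · omega
              · exact hGK (hG1.symm.trans hK)
        have h := IH (ip 2) (by omega)
          (fun n => typ (n + 1 + 1)) (fun n => ip (n + 1 + 1)) (fun n => mbar (n + 1 + 1))
          (fun n => bbar (n + 1 + 1)) (fun n => caseI (n + 1 + 1)) (L - 2) rfl
          (fun n hn => hlaw (n + 1 + 1) (by omega))
        omega

/-- **H3 · no infinite GRK chain**: no infinite sequence obeys the GRK chain law at every step.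
[OURS · L1 W4.5c] -/
theorem not_infinite {G R K : α} (hGR : G ≠ R) (hGK : G ≠ K) (hRK : R ≠ K)
    (typ : ℕ → α) (ip mbar bbar : ℕ → ℕ) (caseI : ℕ → Bool) :
    ¬ (∀ n, ip (n + 1) ≤ ip n ∧
        (ip (n + 1) = ip n → 0 < ip n →
          (typ n = G ∧ caseI n = false ∧ mbar n = 1 ∧ typ (n + 1) = R) ∨
          (typ n = K ∧ caseI n = true ∧ bbar n = 1 ∧ typ (n + 1) = G ∧ 2 ≤ mbar (n + 1))) ∧
        (ip n = 0 → typ n = R ∧ typ (n + 1) = K ∧ ip (n + 1) = 0)) := by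
  intro h
  have := length_le hGR hGK hRK (ip 0) typ ip mbar bbar caseI (2 * ip 0 + 2) rfl
    (fun n _ => h n)
  omega

end Summit.ResolutionOfSingularities.ResolutionOfSingularities.Theorems.WildQuotientResolution.GRKChain
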